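import Mathlib
import Summits.Ventures.DiscreteObjects.Mahler.MeasureOneQuadratic
import Summits.Ventures.DiscreteObjects.Mahler.SmythTrinomialIrreducible
import Summits.Ventures.DiscreteObjects.Mahler.GoldenRatioSharpness
import Summits.Ventures.DiscreteObjects.Mahler.GraeffeIdentity
import Summits.Ventures.DiscreteObjects.Mahler.Height1CellSymmetry

/-!
# Census rows of degrees 1, 2, 3 in the kernel (venture `DiscreteObjects`, target L)

Cell `pub-namedobj`, seat `pub-namedobj-mahler` (gen 10). Framing: lottery ticket; floor = certified
bounds/negative ranges.

The census vocabulary of the cell (`DegreeCensus n B L`: every irreducible integer polynomial of degree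
`n` with Mahler measure in `(1, B)` is, up to sign and `x ↦ -x`, in the list `L`) instantiated in the
three degrees where no computation is needed — the first rows of the table of minimal Mahler measures by
degree (Boyd 1980; Mossinghoff 1998), ZERO compute:

* degree 1: `degreeCensus_one` — `DegreeCensus 1 B []` for every `B ≤ 2` (`M(aX + b) = max(|a|,|b|) ∈ ℕ`);
* degree 2: `degreeCensus_two` — `DegreeCensus 2 2 [x² - x - 1]`: the irreducible quadratics with
  `1 < M < 2` are `±(x² ± x - 1)` (measure `(1+√5)/2`); `degreeCensus_two_empty` — `DegreeCensus 2 B []`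
  for `B ≤ (1+√5)/2`;
* degree 3: `degreeCensus_three` — `DegreeCensus 3 1.3248 [x³ - x - 1, x³ - x² + 1]`: by Smyth's theorem
  with its isolation and equality statements ([McKee–Smyth, Thm 12.1], kernel gen 8/9), an irreducible
  cubic — necessarily nonreciprocal with nonzero constant term — of measure `< 1.3248` has measure
  `θ₀ = 1.3247…` and is `±(x³ ∓ x ∓ 1)` or `±(x³ ∓ x² ± 1)`; `degreeCensus_three_empty` —
  `DegreeCensus 3 B []` for `B ≤ θ₀`.
-/

namespace Summit.Ventures.DiscreteObjects.Mahler

open Polynomial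

/-! ### Small tools -/

/-- An irreducible polynomial of degree `≥ 2` has no integer root (local copy of a standard fact). -/
private theorem not_isRoot_of_irreducible {p : ℤ[X]} (hirr : Irreducible p) (hdeg : 2 ≤ p.natDegree) (t : ℤ) :
    p.eval t ≠ 0 := by
  intro ht
  have hdvd : X - C t ∣ p := dvd_iff_isRoot.mpr ht
  have hass : Associated (X - C t) p := (irreducible_X_sub_C t).associated_of_dvd hirr hdvd
  have h1 := natDegree_eq_of_degree_eq (degree_eq_degree_of_associated hass)
  rw [natDegree_X_sub_C] at h1
  omega

/-- An irreducible polynomial of degree `≥ 2` has nonzero constant term. -/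
theorem coeff_zero_ne_zero_of_irreducible {p : ℤ[X]} (hirr : Irreducible p) (hdeg : 2 ≤ p.natDegree) :
    p.coeff 0 ≠ 0 := by
  rw [coeff_zero_eq_eval_zero]
  have h := not_isRoot_of_irreducible hirr hdeg 0
  rwa [show ((0 : ℤ) : ℤ) = 0 from rfl] at h

/-- Normalisation to a monic polynomial: if `|lc(p)| = 1` then `m := C (lc p) * p` is monic, `p = C (lc p) * m`,
`M(m) = M(p)`, `deg m = deg p`, and `m` is irreducible iff `p` is. -/
theorem monic_normalisation {p : ℤ[X]} (hlc : p.leadingCoeff = 1 ∨ p.leadingCoeff = -1) :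
    (C p.leadingCoeff * p).Monic ∧ p = C p.leadingCoeff * (C p.leadingCoeff * p) ∧
      intMahlerMeasure (C p.leadingCoeff * p) = intMahlerMeasure p ∧
      (C p.leadingCoeff * p).natDegree = p.natDegree ∧
      (Irreducible p → Irreducible (C p.leadingCoeff * p)) := by
  have hs2 : p.leadingCoeff * p.leadingCoeff = 1 := by rcases hlc with h | h <;> simp [h]
  have hunit : IsUnit (C p.leadingCoeff) := isUnit_C.mpr (IsUnit.of_mul_eq_one _ hs2)
  have hs0 : p.leadingCoeff ≠ 0 := by rcases hlc with h | h <;> simp [h]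
  refine ⟨?_, ?_, ?_, ?_, fun hirr => (irreducible_isUnit_mul hunit).mpr hirr⟩
  · rw [Monic, leadingCoeff_mul, leadingCoeff_C, hs2]
  · rw [← mul_assoc, ← C_mul, hs2, C_1, one_mul]
  · rw [intMahlerMeasure_mul, intMahlerMeasure_C]
    rcases hlc with h | h <;> simp [h]
  · exact natDegree_C_mul hs0

/-- A root of a monic integer quadratic in `[lo, hi]` from a sign change, and the bound `M ≥ |r|`. -/
theorem le_intMahlerMeasure_of_sign_change {b : ℤ[X]} (hdeg : b.natDegree = 2) (hmonic : b.coeff 2 = 1)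
    {lo hi : ℝ} (hlohi : lo ≤ hi)
    (hsign : (lo ^ 2 + (b.coeff 1 : ℝ) * lo + (b.coeff 0 : ℝ) ≤ 0 ∧
        0 ≤ hi ^ 2 + (b.coeff 1 : ℝ) * hi + (b.coeff 0 : ℝ)) ∨
      (0 ≤ lo ^ 2 + (b.coeff 1 : ℝ) * lo + (b.coeff 0 : ℝ) ∧
        hi ^ 2 + (b.coeff 1 : ℝ) * hi + (b.coeff 0 : ℝ) ≤ 0)) :
    ∃ r : ℝ, lo ≤ r ∧ r ≤ hi ∧ |r| ≤ intMahlerMeasure b := by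
  set f : ℝ → ℝ := fun x => x ^ 2 + (b.coeff 1 : ℝ) * x + (b.coeff 0 : ℝ) with hf
  have hcont : Continuous f := by rw [hf]; fun_prop
  obtain ⟨r, hrI, hrf⟩ : ∃ r ∈ Set.Icc lo hi, f r = 0 := by
    rcases hsign with ⟨hlo, hhi⟩ | ⟨hlo, hhi⟩
    · exact intermediate_value_Icc hlohi hcont.continuousOn ⟨hlo, hhi⟩
    · exact intermediate_value_Icc' hlohi hcont.continuousOn ⟨hhi, hlo⟩
  have hmon : b.Monic := by rw [Monic, leadingCoeff, hdeg, hmonic]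
  have hroot : aeval (r : ℂ) b = 0 := by
    rw [aeval_quadratic_real hdeg hmonic]
    have : f r = 0 := hrf
    rw [hf] at this
    simp only at this
    rw [this]; simp
  have hle := norm_root_le_intMahlerMeasure hmon hroot
  rw [Complex.norm_real, Real.norm_eq_abs] at hle
  exact ⟨r, hrI.1, hrI.2, hle⟩

/-! ### Degree 1 -/

/-- `M(aX + b) = max(|a|, |b|)` for a degree-one integer polynomial. -/
theorem intMahlerMeasure_of_natDegree_eq_one {p : ℤ[X]} (hdeg : p.natDegree = 1) :
    intMahlerMeasure p = max |(p.coeff 1 : ℝ)| |(p.coeff 0 : ℝ)| := by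
  unfold intMahlerMeasure
  have hdeg' : (p.map (Int.castRingHom ℂ)).degree = 1 := by
    rw [degree_map_eq_of_injective (Int.castRingHom ℂ).injective_int, degree_eq_natDegree, hdeg]
    · rfl
    · rintro rfl; simp at hdeg
  rw [mahlerMeasure_of_degree_eq_one hdeg', coeff_map, coeff_map, eq_intCast, eq_intCast,
    Complex.norm_intCast, Complex.norm_intCast]

/-- **Degree-1 census row:** `DegreeCensus 1 B []` for every `B ≤ 2` — an integer polynomial `aX + b`
has `M = max(|a|,|b|) ∈ ℕ`, so `M > 1` forces `M ≥ 2`. -/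
theorem degreeCensus_one {B : ℝ} (hB : B ≤ 2) : DegreeCensus 1 B [] := by
  intro p hdeg _ h1 hB'
  exfalso
  rw [intMahlerMeasure_of_natDegree_eq_one hdeg] at h1 hB'
  have key : ∀ z : ℤ, (1 : ℝ) < |(z : ℝ)| → (2 : ℝ) ≤ |(z : ℝ)| := by
    intro z hz
    have h' : (1 : ℤ) < |z| := by exact_mod_cast hz
    have : (2 : ℤ) ≤ |z| := h'
    exact_mod_cast this
  rcases le_max_iff.mp (le_refl (max |(p.coeff 1 : ℝ)| |(p.coeff 0 : ℝ)|)) with h | h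
  · have := key _ (lt_of_lt_of_le h1 h); linarith [le_max_left |(p.coeff 1 : ℝ)| |(p.coeff 0 : ℝ)|]
  · have := key _ (lt_of_lt_of_le h1 h); linarith [le_max_right |(p.coeff 1 : ℝ)| |(p.coeff 0 : ℝ)|]

/-! ### Degree 2 -/

/-- **Monic irreducible quadratics of measure in `(1, 2)`** are `x² ± x - 1`. -/
theorem monic_quadratic_measure_lt_two {m : ℤ[X]} (hirr : Irreducible m) (hdeg : m.natDegree = 2)
    (hmonic : m.Monic) (h1 : 1 < intMahlerMeasure m) (h2 : intMahlerMeasure m < 2) :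
    m.coeff 0 = -1 ∧ (m.coeff 1 = 1 ∨ m.coeff 1 = -1) := by
  have hc2 : m.coeff 2 = 1 := by rw [← hdeg]; exact hmonic
  have hc0le : (|m.coeff 0| : ℝ) ≤ intMahlerMeasure m := abs_coeff_zero_le_intMahlerMeasure hmonic
  have hc0Z : |m.coeff 0| ≤ 1 := by
    by_contra h
    push Not at h
    have : (2 : ℝ) ≤ (|m.coeff 0| : ℝ) := by
      have : (2 : ℤ) ≤ |m.coeff 0| := h
      exact_mod_cast this
    linarith
  have hc0ne : m.coeff 0 ≠ 0 := coeff_zero_ne_zero_of_irreducible hirr (by omega)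
  have hnoroot : ∀ t : ℤ, m.eval t ≠ 0 := not_isRoot_of_irreducible hirr (by omega)
  have hm : m = X ^ 2 + C (m.coeff 1) * X + C (m.coeff 0) := quadratic_eq_of_coeff hdeg hc2
  set b := m.coeff 1 with hb
  set c := m.coeff 0 with hc
  have hcases : c = 1 ∨ c = -1 := by
    rcases abs_le.mp hc0Z with ⟨h1', h2'⟩
    omega
  rcases hcases with hc1 | hc1
  · -- `c = 1`: `|b| ≤ 2` gives measure `1` or a root `∓1`; `|b| ≥ 3` gives a real root of modulus `≥ 2`
    exfalso
    by_cases hb3 : 3 ≤ b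
    · -- root in `[-b-1, -2]`
      have hbR : (3 : ℝ) ≤ b := by exact_mod_cast hb3
      obtain ⟨r, hr1, hr2, hrM⟩ := le_intMahlerMeasure_of_sign_change hdeg hc2
        (lo := -(b : ℝ) - 1) (hi := -2) (by linarith)
        (Or.inr ⟨by rw [← hb, ← hc, hc1]; push_cast; nlinarith, by rw [← hb, ← hc, hc1]; push_cast; nlinarith⟩)
      have : (2 : ℝ) ≤ |r| := by rw [abs_of_neg (by linarith)]; linarith
      linarith
    by_cases hb3' : b ≤ -3
    · -- root in `[2, -b+1]`
      have hbR : (b : ℝ) ≤ -3 := by exact_mod_cast hb3'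
      obtain ⟨r, hr1, hr2, hrM⟩ := le_intMahlerMeasure_of_sign_change hdeg hc2
        (lo := 2) (hi := -(b : ℝ) + 1) (by linarith)
        (Or.inl ⟨by rw [← hb, ← hc, hc1]; push_cast; nlinarith, by rw [← hb, ← hc, hc1]; push_cast; nlinarith⟩)
      have : (2 : ℝ) ≤ |r| := by rw [abs_of_pos (by linarith)]; linarith
      linarith
    -- `|b| ≤ 2`: measure one
    push Not at hb3 hb3'
    have hM1 : intMahlerMeasure m = 1 := by
      rcases le_or_gt b (-2) with hb2 | hb2
      · -- b = -2: m = (X - 1)², root 1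
        exfalso
        have hb2' : b = -2 := by omega
        apply hnoroot 1
        rw [hm, hc1, hb2']; simp
      rcases le_or_gt 2 b with hb2' | hb2'
      · exfalso
        have hb2'' : b = 2 := by omega
        apply hnoroot (-1)
        rw [hm, hc1, hb2'']; simp
      -- `-2 < b < 2`: `x² + bx + 1 = x² - (-b) x + 1` with `|-b| < 2`
      have hmC : m.map (Int.castRingHom ℂ) = X ^ 2 - C (((-b : ℤ) : ℝ) : ℂ) * X + 1 := by
        rw [hm, hc1]
        simp only [Polynomial.map_add, Polynomial.map_mul, Polynomial.map_pow, map_X, Polynomial.map_C]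
        simp only [eq_intCast, Int.cast_neg, Complex.ofReal_neg, Complex.ofReal_intCast, map_neg, map_one]
        ring
      unfold intMahlerMeasure
      rw [hmC]
      exact mahlerMeasure_quad_of_abs_lt_two (by exact_mod_cast (show (-2 : ℤ) < -b by omega))
        (by exact_mod_cast (show -b < (2 : ℤ) by omega))
    linarith
  · -- `c = -1`: `b = 0` is reducible; `|b| ≥ 2` gives a real root of modulus `≥ 2`; `|b| = 1` remains
    refine ⟨hc1, ?_⟩
    by_cases hb2 : 2 ≤ b
    · exfalso
      have hbR : (2 : ℝ) ≤ b := by exact_mod_cast hb2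
      obtain ⟨r, hr1, hr2, hrM⟩ := le_intMahlerMeasure_of_sign_change hdeg hc2
        (lo := -(b : ℝ) - 1) (hi := -2) (by linarith)
        (Or.inr ⟨by rw [← hb, ← hc, hc1]; push_cast; nlinarith, by rw [← hb, ← hc, hc1]; push_cast; nlinarith⟩)
      have : (2 : ℝ) ≤ |r| := by rw [abs_of_neg (by linarith)]; linarith
      linarith
    by_cases hb2' : b ≤ -2
    · exfalso
      have hbR : (b : ℝ) ≤ -2 := by exact_mod_cast hb2'
      obtain ⟨r, hr1, hr2, hrM⟩ := le_intMahlerMeasure_of_sign_change hdeg hc2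
        (lo := 2) (hi := -(b : ℝ) + 1) (by linarith)
        (Or.inl ⟨by rw [← hb, ← hc, hc1]; push_cast; nlinarith, by rw [← hb, ← hc, hc1]; push_cast; nlinarith⟩)
      have : (2 : ℝ) ≤ |r| := by rw [abs_of_pos (by linarith)]; linarith
      linarith
    push Not at hb2 hb2'
    have hb0 : b ≠ 0 := by
      intro hb0
      apply hnoroot 1
      rw [hm, hc1, hb0]; simp
    omega

/-- **Degree-2 census row:** `DegreeCensus 2 2 [x² - x - 1]` — every irreducible integer quadratic with
`1 < M < 2` is `±(x² - x - 1)` or `±(x² + x - 1)` (measure `(1+√5)/2`). -/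
theorem degreeCensus_two : DegreeCensus 2 2 [[-1, -1, 1]] := by
  intro p hdeg hirr h1 h2
  -- `|lc(p)| = 1`
  have hlc : (|p.leadingCoeff| : ℝ) ≤ intMahlerMeasure p := abs_leadingCoeff_le_intMahlerMeasure p
  have hlc1 : p.leadingCoeff = 1 ∨ p.leadingCoeff = -1 := by
    have hne : p.leadingCoeff ≠ 0 := leadingCoeff_ne_zero.mpr hirr.ne_zero
    have hle : |p.leadingCoeff| ≤ 1 := by
      by_contra h
      push Not at h
      have : (2 : ℝ) ≤ (|p.leadingCoeff| : ℝ) := by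
        have : (2 : ℤ) ≤ |p.leadingCoeff| := h
        exact_mod_cast this
      linarith
    rcases abs_le.mp hle with ⟨h1', h2'⟩
    omega
  obtain ⟨hmonic, hpm, hMm, hdegm, hirrm⟩ := monic_normalisation hlc1
  set m := C p.leadingCoeff * p with hmdef
  rw [← hMm] at h1 h2
  rw [hdeg] at hdegm
  obtain ⟨hc0, hb⟩ := monic_quadratic_measure_lt_two (hirrm hirr) hdegm hmonic h1 h2
  have hm : m = X ^ 2 + C (m.coeff 1) * X + C (m.coeff 0) :=
    quadratic_eq_of_coeff hdegm (by rw [← hdegm]; exact hmonic)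
  have hℓ : ofCoeffs [-1, -1, 1] = (X ^ 2 - X - 1 : ℤ[X]) := by
    unfold ofCoeffs; simp [List.zipIdx]; ring
  refine ⟨[-1, -1, 1], List.mem_singleton.mpr rfl, ?_⟩
  rw [hℓ, hpm]
  rcases hb with hb | hb
  · have hm' : m = X ^ 2 + C (1 : ℤ) * X + C (-1) := by rw [hm, hb, hc0]
    rw [hm']
    rcases hlc1 with hs | hs <;> rw [hs]
    · right; right; left
      simp only [map_one, one_mul, map_neg, sub_comp, pow_comp, X_comp, one_comp]; ring
    · right; right; right
      simp only [map_one, one_mul, map_neg, sub_comp, pow_comp, X_comp, one_comp]; ring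
  · have hm' : m = X ^ 2 + C (-1 : ℤ) * X + C (-1) := by rw [hm, hb, hc0]
    rw [hm']
    rcases hlc1 with hs | hs <;> rw [hs]
    · left
      simp only [map_one, map_neg]; ring
    · right; left
      simp only [map_one, map_neg]; ring

/-- **Degree-2 census row, empty form:** `DegreeCensus 2 B []` for `B ≤ (1+√5)/2`: no integer quadratic
has Mahler measure in `(1, (1+√5)/2)`. -/
theorem degreeCensus_two_empty {B : ℝ} (hB : B ≤ (1 + Real.sqrt 5) / 2) : DegreeCensus 2 B [] := by
  intro p hdeg hirr h1 h2
  exfalso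
  have hφ2 : (1 + Real.sqrt 5) / 2 < 2 := by
    have : Real.sqrt 5 < 3 := by
      rw [show (3 : ℝ) = Real.sqrt 9 by rw [show (9:ℝ) = 3 ^ 2 by norm_num, Real.sqrt_sq (by norm_num)]]
      exact Real.sqrt_lt_sqrt (by norm_num) (by norm_num)
    linarith
  obtain ⟨l, hl, hpl⟩ := degreeCensus_two p hdeg hirr h1 (lt_of_lt_of_le h2 (hB.trans hφ2.le))
  rw [List.mem_singleton] at hl
  subst hl
  have hℓ : ofCoeffs [-1, -1, 1] = (X ^ 2 - X - 1 : ℤ[X]) := by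
    unfold ofCoeffs; simp [List.zipIdx]; ring
  rw [hℓ] at hpl
  have hMℓ : intMahlerMeasure (X ^ 2 - X - 1 : ℤ[X]) = Real.goldenRatio := intMahlerMeasure_X_sq_sub_X_sub_one
  have hMp : intMahlerMeasure p = Real.goldenRatio := by
    rcases hpl with h | h | h | h <;> rw [h]
    · exact hMℓ
    · rw [intMahlerMeasure_neg, hMℓ]
    · rw [intMahlerMeasure_comp_neg_X, hMℓ]
    · rw [intMahlerMeasure_neg, intMahlerMeasure_comp_neg_X, hMℓ]
  rw [hMp, Real.goldenRatio] at h2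
  linarith

/-! ### Degree 3 -/

/-- **Degree-3 census row:** `DegreeCensus 3 1.3248 [x³ - x - 1, x³ - x² + 1]` — by Smyth's theorem (with
isolation and the equality case), every irreducible integer cubic with `1 < M < 1.3248` has `M = θ₀` and
is `±(x³ ∓ x ∓ 1)` or `±(x³ ∓ x² ± 1)` (`x ↦ -x` orbits of `x³ - x - 1` and of its reciprocal
`x³ - x² + 1`). -/
theorem degreeCensus_three : DegreeCensus 3 (13248 / 10000) [[-1, -1, 0, 1], [1, 0, -1, 1]] := by
  intro p hdeg hirr h1 h2
  have h0 : p.coeff 0 ≠ 0 := coeff_zero_ne_zero_of_irreducible hirr (by omega)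
  have hnoroot : ∀ t : ℤ, p.eval t ≠ 0 := not_isRoot_of_irreducible hirr (by omega)
  have hrev1 : p.reverse ≠ p := by
    intro h
    exact hnoroot (-1) (eval_neg_one_eq_zero_of_reverse_eq h (by rw [hdeg]; decide))
  have hrev2 : p.reverse ≠ -p := fun h => hnoroot 1 (eval_one_eq_zero_of_reverse_eq_neg h)
  have hMθ : intMahlerMeasure p = smythTheta := intMahlerMeasure_eq_smythTheta_of_lt hirr h0 hrev1 hrev2 h2
  obtain ⟨k, hk, a, ha, s, hs, hform⟩ := (intMahlerMeasure_eq_smythTheta_iff_eq hirr h0 hrev1 hrev2).mp hMθ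
  -- the degree forces `k = 1`
  have ha0 : a ≠ 0 := by rcases ha with h | h <;> simp [h]
  have hs0 : s ≠ 0 := by rcases hs with h | h <;> simp [h]
  have hdegP : (1 - X ^ (2 * k) + C a * X ^ (3 * k) : ℤ[X]).natDegree = 3 * k := by
    have : (1 - X ^ (2 * k) + C a * X ^ (3 * k) : ℤ[X]) = trinomial 0 (2 * k) (3 * k) 1 (-1) a := by
      rw [trinomial_def]; simp; ring
    rw [this]; exact trinomial_natDegree (by omega) (by omega) ha0
  have hdegQ : (1 - C a * X ^ k + C a * X ^ (3 * k) : ℤ[X]).natDegree = 3 * k := by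
    have : (1 - C a * X ^ k + C a * X ^ (3 * k) : ℤ[X]) = trinomial 0 k (3 * k) 1 (-a) a := by
      rw [trinomial_def]; simp; ring
    rw [this]; exact trinomial_natDegree (by omega) (by omega) ha0
  have hk1 : k = 1 := by
    rcases hform with h | h
    · have := congrArg natDegree h
      rw [hdeg, natDegree_C_mul hs0, hdegP] at this
      omega
    · have := congrArg natDegree h
      rw [hdeg, natDegree_C_mul hs0, hdegQ] at this
      omega
  subst hk1
  have hℓ₁ : ofCoeffs [-1, -1, 0, 1] = (X ^ 3 - X - 1 : ℤ[X]) := by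
    unfold ofCoeffs; simp [List.zipIdx]; ring
  have hℓ₂ : ofCoeffs [1, 0, -1, 1] = (X ^ 3 - X ^ 2 + 1 : ℤ[X]) := by
    unfold ofCoeffs; simp [List.zipIdx]; ring
  rcases hform with h | h
  · -- `p = s (1 - X² + a X³)`: the orbit of `x³ - x² + 1`
    refine ⟨[1, 0, -1, 1], by simp, ?_⟩
    rw [hℓ₂, h]
    rcases hs with rfl | rfl <;> rcases ha with rfl | rfl
    · left; simp
      ring
    · right; right; left; simp; ring
    · right; left; simp; ring
    · right; right; right; simp; ring
  · -- `p = s (1 - a X + a X³)`: the orbit of `x³ - x - 1`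
    refine ⟨[-1, -1, 0, 1], by simp, ?_⟩
    rw [hℓ₁, h]
    rcases hs with rfl | rfl <;> rcases ha with rfl | rfl
    · right; right; right; simp; ring
    · right; left; simp; ring
    · right; right; left; simp; ring
    · left; simp; ring

/-- **Degree-3 census row, empty form:** `DegreeCensus 3 B []` for `B ≤ θ₀ = 1.3247…`: no integer cubic
has Mahler measure in `(1, θ₀)`. -/
theorem degreeCensus_three_empty {B : ℝ} (hB : B ≤ smythTheta) : DegreeCensus 3 B [] := by
  intro p hdeg hirr h1 h2
  exfalso
  have h0 : p.coeff 0 ≠ 0 := coeff_zero_ne_zero_of_irreducible hirr (by omega)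
  have hnoroot : ∀ t : ℤ, p.eval t ≠ 0 := not_isRoot_of_irreducible hirr (by omega)
  have hrev1 : p.reverse ≠ p := by
    intro h
    exact hnoroot (-1) (eval_neg_one_eq_zero_of_reverse_eq h (by rw [hdeg]; decide))
  have hrev2 : p.reverse ≠ -p := fun h => hnoroot 1 (eval_one_eq_zero_of_reverse_eq_neg h)
  have := intMahlerMeasure_ge_smythTheta_of_nonreciprocal h0 hrev1 hrev2
  linarith

end Summit.Ventures.DiscreteObjects.Mahler
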